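import Mathlib
import HarnessLib
import Summits.AtomisticToContinuum.FouriersLaw.Theses.LogConcaveRigidity

/-!
# Birth skeleton (BC3) for crux `LogConcaveRigidity.NessWindowLogConcavity`
(item `stmt-AtomisticToContinuum-16561`, route `route-AtomisticToContinuum-LogConcaveRigidity`, rank 3;
sub-problem `FouriersLaw`; registrar `planner-skel-stmt-AtomisticToContinuum-16561-0`, 2026-08-17)

Crux (FIXED, concluded BY NAME below): for `pinnedChain ω₂ lam β γ` (all `> 0`) and every `T > 0`
there is `δ₀ > 0` such that for every bias `0 < δ < δ₀` with `T - δ/2 > 0`, every `N`, every weak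
steady state `μ` of the `N`-chain at `(T + δ/2, T - δ/2)` and every window `{a, …, a+n} ⊆ {0, …, N-1}`,
the window marginal of `μ` satisfies Borell's multiplicative Brunn–Minkowski inequality
`m(A)^θ · m(B)^(1-θ) ≤ m(θA + (1-θ)B)` (Borel `A, B`, `0 < θ < 1`).

## Line `birth` — N-UNIFORM MODULUS (density side) × PRÉKOPA–LEINDLER–BORELL (convex-geometry side)

The crux is a statement about MEASURES of sets; any proof goes through the steady-state DENSITY
(which exists and is smooth for `N ≥ 1`: `CuneoEckmannHairerReyBellet2018_smoothDensity_holds`, Hörmander,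
proved in tree) and the convexity of its potential `W = -log ρ`.  The line cuts exactly there:

* `stub_uniformModulus` (THE HARD, OPEN STUB; density/perturbative side): for every `T > 0` there is a
  width `δ₀(T) > 0` and, for each admissible bias `δ`, a modulus `κ = κ(T, δ) > 0` NOT depending on `N`
  such that every weak steady state at `(T + δ/2, T - δ/2)` is `e^{-W} · Leb` with
  `W - κ ∑_i (q_i² + p_i²)` CONVEX on phase space — N-uniform STRONG log-concavity of the
  near-equilibrium NESS.  It is the crux's density form `W convex` strengthened by a uniform modulus,
  for three reasons: (i) strong (unlike plain) log-concavity is an OPEN condition, stable under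
  C²-small RELATIVE perturbations, and it is what perturbation theory at `δ = 0` outputs
  (`W₀ = H_N/T + log Z_N`, `Hess(H_N/T) ≥ min(1, ω₂)/T` uniformly in `N` since `U'' = ω₂ + 3 lam q² ≥ ω₂`,
  `V'' = 1 + 3βr² ≥ 1`); (ii) it is TRUE at the harmonic corner `lam = β = 0` (Rieder–Lebowitz–Lieb:
  Gaussian NESS whose covariance is bounded above uniformly in `N` for a pinned chain, so
  `Hess W = C_N⁻¹ ≥ κ`), at `N = 1` (Gibbs at the mean temperature) and in the limit `δ → 0` (Gibbs);
  (iii) it feeds Brascamp–Lieb / Bakry–Émery tools (N-uniform Poincaré and log-Sobolev inequalities for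
  the NESS), which the plain form does not.  The ABSOLUTE perturbative cut "Hess(W_δ - W₀) ≥ -c/2" was
  considered and REJECTED: under the local-temperature heuristic `W_δ ≈ ∑ h_i/T_i` the corrector
  `W_δ - W₀ ≈ ∑ (1/T_i - 1/T) h_i` has Hessian `≈ -(δ/T²)·3 lam q_i²` on the hot side, unbounded below —
  only a RELATIVE bound (the quartic tails of `H` pay for the quartic tails of the correction) can hold,
  and `W - κ q convex` is its weakest useful consequence.  Size XL (same why-might-fail as the crux:
  convexity of `-log ρ_δ` is unprotected in the far tails; no print controls `(−log ρ_δ)''` there).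
* `stub_prekopaLeindlerBorell` (KNOWN THEOREM, to formalise; convex-geometry side): a finite measure
  `e^{-W} · Leb` on phase space with `W` convex satisfies Borell's multiplicative Brunn–Minkowski
  inequality for all Borel `A, B` and `0 < θ < 1` (outer measure on the right: the Minkowski combination
  of Borel sets is analytic, not Borel).  Prékopa 1973 / Leindler 1972 / Borell 1975 Thm 3.1 /
  Brascamp–Lieb 1976 Thm 3.3; the functional inequality `prekopaLeindler_pi` IS in the tree
  (`Literature/Analysis/Convexity/PrekopaLeindler.lean`), so the stub is: transfer to the product
  `(Fin N → ℝ) × (Fin N → ℝ)` (sections + Tonelli, or `sumPiEquivProdPi`), apply it to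
  `f = e^{-W}𝟙_A`, `g = e^{-W}𝟙_B`, `h = e^{-W}𝟙_T` for every MEASURABLE `T ⊇ θA + (1-θ)B`
  (`measure_eq_iInf`), with `ConvexOn.continuousOn` for measurability of `W`.  Size M–L.
* COMPOSITION `NessWindowLogConcavity_of` (sorry-free seam, ~100 lines): `κ ≥ 0` and
  `∑(q_i²+p_i²)` convex give `W` convex (`convexOn_of_sub_quadratic`); the steady state is a probability
  measure, so `e^{-W}·Leb` is finite; Borell for `μ` (stub 2) passes to EVERY window marginal because the
  window map is linear and measurable: `win⁻¹(θA+(1-θ)B) ⊇ θ·win⁻¹A + (1-θ)·win⁻¹B`, `Measure.map_apply`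
  on the Borel sets and `Measure.le_map_apply` on the (possibly non-measurable) combination
  (`window_borell`) — Prékopa's "marginals of log-concave measures are log-concave" in Borell's form.

Hardest stub: `stub_uniformModulus` (it carries the whole analytic difficulty, by design; the modulus
makes it strictly stronger than, and differently checkable from, the crux: MD estimates of the smallest
Hessian eigenvalue of `-log` of small-window histograms must stay bounded away from `0` as `N` grows).
Why the cut is not a costume: stub 1 speaks of the Lebesgue density on the full `2N`-dimensional phase
space and a positive modulus, never of windows or of Borell's inequality; stub 2 is pure convex geometry
(no chain, no baths); neither gives the crux or `FouriersLaw` by `exact? | simpa | aesop` (BC3 probes, folder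
`bc/`, quoted in `Lines/birth.md`).
Disproof used: none on file (`ledger crux ls stmt-AtomisticToContinuum-16561`: no workfiles, no
`Disproof.lean`, no `Negative/` lemma, 2026-08-17).  Refuter evidence respected (REVIEW-LogConcaveRigidity.md,
falsifier F1: window `{0}`, `p ↦ γp + a(p)` non-decreasing): stub 1 implies F1 with room `κ`, so F1 kills
this line before it kills the crux — the line is MORE falsifiable, as a line should be.
-/

noncomputable section

namespace Summit.AtomisticToContinuum.FouriersLaw.Cruxes.NessWindowLogConcavity

namespace Birth

open MeasureTheory Set

/-! ## The two registered stubs -/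

/-- **stub 1 — `stub_uniformModulus` (N-uniform strong log-concavity of the near-equilibrium steady
state; the hard stub).**  For `pinnedChain ω₂ lam β γ` (all `> 0`) and every `T > 0` there is `δ₀ > 0`
such that for every `0 < δ < δ₀` with `T - δ/2 > 0` there is `κ > 0` with: for every `N` and every weak
steady state `μ` of the `N`-chain at `(T + δ/2, T - δ/2)` there is a potential `W : PhaseSpace N → ℝ` with
`μ = e^{-W} · Leb` and `x ↦ W x - κ ∑_i (q_i² + p_i²)` convex on the whole phase space. -/
theorem stub_uniformModulus :
    ∀ ω₂ lam β γ : ℝ, 0 < ω₂ → 0 < lam → 0 < β → 0 < γ → ∀ T : ℝ, 0 < T → ∃ δ₀ : ℝ, 0 < δ₀ ∧ ∀ δ : ℝ, 0 < δ → δ < δ₀ → 0 < T - δ / 2 → ∃ κ : ℝ, 0 < κ ∧ ∀ (N : ℕ) (μ : MeasureTheory.Measure (Literature.MathematicalPhysics.KineticTheory.HeatConduction.PhaseSpace N)), (Literature.MathematicalPhysics.KineticTheory.HeatConduction.pinnedChain ω₂ lam β γ).IsSteadyState N (T + δ / 2) (T - δ / 2) μ → ∃ W : Literature.MathematicalPhysics.KineticTheory.HeatConduction.PhaseSpace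 N → ℝ, μ = (MeasureTheory.volume : MeasureTheory.Measure (Literature.MathematicalPhysics.KineticTheory.HeatConduction.PhaseSpace N)).withDensity (fun x => ENNReal.ofReal (Real.exp (-W x))) ∧ ConvexOn ℝ Set.univ (fun x : Literature.MathematicalPhysics.KineticTheory.HeatConduction.PhaseSpace N => W x - κ * ∑ i : Fin N, ((x.1 i) ^ 2 + (x.2 i) ^ 2)) := by
  sorry

/-- **stub 2 — `stub_prekopaLeindlerBorell` (Prékopa–Leindler ⇒ Borell: a finite measure with a
log-concave Lebesgue density on phase space satisfies the multiplicative Brunn–Minkowski inequality).**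
For every `N`, every convex `W : PhaseSpace N → ℝ` with `e^{-W} · Leb` finite, all Borel `A, B` and
`0 < θ < 1`: `ν(A)^θ · ν(B)^(1-θ) ≤ ν(θA + (1-θ)B)`, `ν := e^{-W} · Leb` (outer measure on the right).
Borell 1975 Thm 3.1; Brascamp–Lieb 1976 Thm 3.3 (`prekopaLeindler_pi`, in tree). -/
theorem stub_prekopaLeindlerBorell :
    ∀ (N : ℕ) (W : Literature.MathematicalPhysics.KineticTheory.HeatConduction.PhaseSpace N → ℝ), ConvexOn ℝ Set.univ W → MeasureTheory.IsFiniteMeasure ((MeasureTheory.volume : MeasureTheory.Measure (Literature.MathematicalPhysics.KineticTheory.HeatConduction.PhaseSpace N)).withDensity (fun x => ENNReal.ofReal (Real.exp (-W x)))) → ∀ (A B : Set (Literature.MathematicalPhysics.KineticTheory.HeatConduction.PhaseSpace N)) (θ : ℝ), MeasurableSet A → MeasurableSet B → 0 < θ → θ < 1 → ((MeasureTheory.volume : MeasureTheory.Measure (Literature.MathematicalPhysics.KineticTheory.HeatConduction.PhaseSpace N)).withDensity (fun x => ENNReal.ofReal (Real.exp (-W x)))) A ^ θ * ((MeasureTheory.volume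 : MeasureTheory.Measure (Literature.MathematicalPhysics.KineticTheory.HeatConduction.PhaseSpace N)).withDensity (fun x => ENNReal.ofReal (Real.exp (-W x)))) B ^ (1 - θ) ≤ ((MeasureTheory.volume : MeasureTheory.Measure (Literature.MathematicalPhysics.KineticTheory.HeatConduction.PhaseSpace N)).withDensity (fun x => ENNReal.ofReal (Real.exp (-W x)))) {z | ∃ x ∈ A, ∃ y ∈ B, z = θ • x + (1 - θ) • y} := by
  sorry

/-! ## Seam lemmas (all sorry-free) -/

open Literature.MathematicalPhysics.KineticTheory.HeatConduction in
/-- The quadratic form `∑_i (q_i² + p_i²)` is convex on phase space. -/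
theorem convexOn_quadratic (N : ℕ) :
    ConvexOn ℝ Set.univ (fun x : PhaseSpace N => ∑ i : Fin N, ((x.1 i) ^ 2 + (x.2 i) ^ 2)) := by
  refine ⟨convex_univ, ?_⟩
  intro x _ y _ a b ha hb hab
  have key : ∀ s t : ℝ, (a * s + b * t) ^ 2 ≤ a * s ^ 2 + b * t ^ 2 := by
    intro s t
    have hb' : b = 1 - a := by linarith
    subst hb'
    nlinarith [mul_nonneg (mul_nonneg ha hb) (sq_nonneg (s - t))]
  simp only [smul_eq_mul, Finset.mul_sum, ← Finset.sum_add_distrib]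
  refine Finset.sum_le_sum fun i _ => ?_
  simp only [Prod.fst_add, Prod.snd_add, Pi.add_apply, Prod.smul_fst, Prod.smul_snd, Pi.smul_apply,
    smul_eq_mul]
  have h1 := key (x.1 i) (y.1 i)
  have h2 := key (x.2 i) (y.2 i)
  linarith

open Literature.MathematicalPhysics.KineticTheory.HeatConduction in
/-- A potential which is convex up to `-κ ∑ (q_i²+p_i²)` with `κ ≥ 0` is convex. -/
theorem convexOn_of_sub_quadratic {N : ℕ} {W : PhaseSpace N → ℝ} {κ : ℝ} (hκ : 0 ≤ κ)
    (h : ConvexOn ℝ Set.univ (fun x : PhaseSpace N => W x - κ * ∑ i : Fin N, ((x.1 i) ^ 2 + (x.2 i) ^ 2))) :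
    ConvexOn ℝ Set.univ W := by
  have hq : ConvexOn ℝ Set.univ (κ • fun x : PhaseSpace N => ∑ i : Fin N, ((x.1 i) ^ 2 + (x.2 i) ^ 2)) :=
    (convexOn_quadratic N).smul hκ
  have hsum := h.add hq
  have e : ((fun x : PhaseSpace N => W x - κ * ∑ i : Fin N, ((x.1 i) ^ 2 + (x.2 i) ^ 2)) +
      κ • fun x : PhaseSpace N => ∑ i : Fin N, ((x.1 i) ^ 2 + (x.2 i) ^ 2)) = W := by
    funext x
    simp only [Pi.add_apply, Pi.smul_apply, smul_eq_mul]
    ring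
  rw [e] at hsum
  exact hsum

open Literature.MathematicalPhysics.KineticTheory.HeatConduction in
/-- The window map `x ↦ (i ↦ (q_{a+i}, p_{a+i}))` is measurable. -/
theorem measurable_window {N : ℕ} (a n : ℕ) (h : a + (n + 1) ≤ N) :
    Measurable (fun x : PhaseSpace N => fun i : Fin (n + 1) =>
      (x.1 (Fin.castLE h (Fin.natAdd a i)), x.2 (Fin.castLE h (Fin.natAdd a i)))) := by
  refine measurable_pi_lambda _ fun i => ?_
  exact ((measurable_pi_apply _).comp measurable_fst).prodMk
    ((measurable_pi_apply _).comp measurable_snd)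

open Literature.MathematicalPhysics.KineticTheory.HeatConduction in
/-- The window map is linear, so the Minkowski combination of preimages lies in the preimage of the
Minkowski combination. -/
theorem window_comb_subset {N : ℕ} (a n : ℕ) (h : a + (n + 1) ≤ N)
    (A B : Set (Fin (n + 1) → ℝ × ℝ)) (θ : ℝ) :
    {z : PhaseSpace N |
        ∃ x ∈ (fun x : PhaseSpace N => fun i : Fin (n + 1) =>
            (x.1 (Fin.castLE h (Fin.natAdd a i)), x.2 (Fin.castLE h (Fin.natAdd a i)))) ⁻¹' A,
        ∃ y ∈ (fun x : PhaseSpace N => fun i : Fin (n + 1) =>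
            (x.1 (Fin.castLE h (Fin.natAdd a i)), x.2 (Fin.castLE h (Fin.natAdd a i)))) ⁻¹' B,
        z = θ • x + (1 - θ) • y} ⊆
      (fun x : PhaseSpace N => fun i : Fin (n + 1) =>
          (x.1 (Fin.castLE h (Fin.natAdd a i)), x.2 (Fin.castLE h (Fin.natAdd a i)))) ⁻¹'
        {z | ∃ x ∈ A, ∃ y ∈ B, z = θ • x + (1 - θ) • y} := by
  rintro z ⟨x, hx, y, hy, rfl⟩
  refine ⟨_, hx, _, hy, ?_⟩
  funext i
  simp only [Pi.add_apply, Pi.smul_apply, Prod.fst_add, Prod.snd_add, Prod.smul_fst, Prod.smul_snd,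
    smul_eq_mul, Prod.smul_mk, Prod.mk_add_mk]

open Literature.MathematicalPhysics.KineticTheory.HeatConduction in
/-- **Borell's inequality passes to window marginals** (Prékopa: linear images of log-concave measures
are log-concave, in Borell's set-function form; `map_apply` on the Borel sets, `le_map_apply` on the
possibly non-measurable Minkowski combination). -/
theorem window_borell {N : ℕ} (μ : Measure (PhaseSpace N))
    (hB : ∀ (A B : Set (PhaseSpace N)) (θ : ℝ), MeasurableSet A → MeasurableSet B → 0 < θ → θ < 1 →
      μ A ^ θ * μ B ^ (1 - θ) ≤ μ {z | ∃ x ∈ A, ∃ y ∈ B, z = θ • x + (1 - θ) • y})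
    (a n : ℕ) (h : a + (n + 1) ≤ N) (A B : Set (Fin (n + 1) → ℝ × ℝ)) (θ : ℝ)
    (hA : MeasurableSet A) (hBm : MeasurableSet B) (hθ : 0 < θ) (hθ1 : θ < 1) :
    (μ.map (fun x => fun i : Fin (n + 1) =>
        (x.1 (Fin.castLE h (Fin.natAdd a i)), x.2 (Fin.castLE h (Fin.natAdd a i))))) A ^ θ *
      (μ.map (fun x => fun i : Fin (n + 1) =>
        (x.1 (Fin.castLE h (Fin.natAdd a i)), x.2 (Fin.castLE h (Fin.natAdd a i))))) B ^ (1 - θ) ≤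
      (μ.map (fun x => fun i : Fin (n + 1) =>
        (x.1 (Fin.castLE h (Fin.natAdd a i)), x.2 (Fin.castLE h (Fin.natAdd a i)))))
        {z | ∃ x ∈ A, ∃ y ∈ B, z = θ • x + (1 - θ) • y} := by
  have hw := measurable_window (N := N) a n h
  rw [Measure.map_apply hw hA, Measure.map_apply hw hBm]
  calc μ ((fun x : PhaseSpace N => fun i : Fin (n + 1) =>
            (x.1 (Fin.castLE h (Fin.natAdd a i)), x.2 (Fin.castLE h (Fin.natAdd a i)))) ⁻¹' A) ^ θ *
        μ ((fun x : PhaseSpace N => fun i : Fin (n + 1) =>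
            (x.1 (Fin.castLE h (Fin.natAdd a i)), x.2 (Fin.castLE h (Fin.natAdd a i)))) ⁻¹' B) ^ (1 - θ)
      ≤ μ {z : PhaseSpace N |
          ∃ x ∈ (fun x : PhaseSpace N => fun i : Fin (n + 1) =>
              (x.1 (Fin.castLE h (Fin.natAdd a i)), x.2 (Fin.castLE h (Fin.natAdd a i)))) ⁻¹' A,
          ∃ y ∈ (fun x : PhaseSpace N => fun i : Fin (n + 1) =>
              (x.1 (Fin.castLE h (Fin.natAdd a i)), x.2 (Fin.castLE h (Fin.natAdd a i)))) ⁻¹' B,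
          z = θ • x + (1 - θ) • y} :=
        hB _ _ θ (hA.preimage hw) (hBm.preimage hw) hθ hθ1
    _ ≤ μ ((fun x : PhaseSpace N => fun i : Fin (n + 1) =>
            (x.1 (Fin.castLE h (Fin.natAdd a i)), x.2 (Fin.castLE h (Fin.natAdd a i)))) ⁻¹'
          {z | ∃ x ∈ A, ∃ y ∈ B, z = θ • x + (1 - θ) • y}) :=
        measure_mono (window_comb_subset a n h A B θ)
    _ ≤ _ := Measure.le_map_apply hw.aemeasurable _

/-! ## The composition -/

/-- **Skeleton theorem — the crux `LogConcaveRigidity.NessWindowLogConcavity` BY NAME from the two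
registered stubs** (the only theorem of this file concluding the crux; its `sorry`s are exactly those of
`stub_uniformModulus` and `stub_prekopaLeindlerBorell`): strong log-concavity with `κ ≥ 0` gives a convex
potential, the steady state is a probability measure so `e^{-W}·Leb` is finite, Prékopa–Leindler–Borell
gives Borell's inequality on phase space, and `window_borell` pushes it to every window marginal. -/
theorem NessWindowLogConcavity_of :
    (∀ ω₂ lam β γ : ℝ, 0 < ω₂ → 0 < lam → 0 < β → 0 < γ → ∀ T : ℝ, 0 < T → ∃ δ₀ : ℝ, 0 < δ₀ ∧ ∀ δ : ℝ, 0 < δ → δ < δ₀ → 0 < T - δ / 2 → ∃ κ : ℝ, 0 < κ ∧ ∀ (N : ℕ) (μ : MeasureTheory.Measure (Literature.MathematicalPhysics.KineticTheory.HeatConduction.PhaseSpace N)), (Literature.MathematicalPhysics.KineticTheory.HeatConduction.pinnedChain ω₂ lam β γ).IsSteadyState N (T + δ / 2) (T - δ / 2) μ → ∃ W : Literature.MathematicalPhysics.KineticTheory.HeatConduction.PhaseSpace N → ℝ, μ = (MeasureTheory.volume : MeasureTheory.Measure (Literature.MathematicalPhysics.KineticTheory.HeatConduction.PhaseSpace N)).withDensity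 (fun x => ENNReal.ofReal (Real.exp (-W x))) ∧ ConvexOn ℝ Set.univ (fun x : Literature.MathematicalPhysics.KineticTheory.HeatConduction.PhaseSpace N => W x - κ * ∑ i : Fin N, ((x.1 i) ^ 2 + (x.2 i) ^ 2))) →
    (∀ (N : ℕ) (W : Literature.MathematicalPhysics.KineticTheory.HeatConduction.PhaseSpace N → ℝ), ConvexOn ℝ Set.univ W → MeasureTheory.IsFiniteMeasure ((MeasureTheory.volume : MeasureTheory.Measure (Literature.MathematicalPhysics.KineticTheory.HeatConduction.PhaseSpace N)).withDensity (fun x => ENNReal.ofReal (Real.exp (-W x)))) → ∀ (A B : Set (Literature.MathematicalPhysics.KineticTheory.HeatConduction.PhaseSpace N)) (θ : ℝ), MeasurableSet A → MeasurableSet B → 0 < θ → θ < 1 → ((MeasureTheory.volume : MeasureTheory.Measure (Literature.MathematicalPhysics.KineticTheory.HeatConduction.PhaseSpace N)).withDensity (fun x => ENNReal.ofReal (Real.exp (-W x)))) A ^ θ * ((MeasureTheory.volume : MeasureTheory.Measure (Literature.MathematicalPhysics.KineticTheory.HeatConduction.PhaseSpace N)).withDensity (fun x => ENNReal.ofReal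 (Real.exp (-W x)))) B ^ (1 - θ) ≤ ((MeasureTheory.volume : MeasureTheory.Measure (Literature.MathematicalPhysics.KineticTheory.HeatConduction.PhaseSpace N)).withDensity (fun x => ENNReal.ofReal (Real.exp (-W x)))) {z | ∃ x ∈ A, ∃ y ∈ B, z = θ • x + (1 - θ) • y}) →
    _root_.Summit.AtomisticToContinuum.FouriersLaw.Theses.LogConcaveRigidity.NessWindowLogConcavity := by
  intro h1 h2 ω₂ lam β γ hω hl hβ hγ T hT
  obtain ⟨δ₀, hδ₀, H⟩ := h1 ω₂ lam β γ hω hl hβ hγ T hT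
  refine ⟨δ₀, hδ₀, ?_⟩
  intro δ hδ hδlt hTδ N μ hμ a n h A B θ hA hB hθ hθ1
  obtain ⟨κ, hκ, Hκ⟩ := H δ hδ hδlt hTδ
  obtain ⟨W, hμW, hconv⟩ := Hκ N μ hμ
  -- the potential is convex (modulus `κ ≥ 0` + the convex quadratic form)
  have hW : ConvexOn ℝ Set.univ W := convexOn_of_sub_quadratic hκ.le hconv
  -- the steady state is a probability measure, so `e^{-W}·Leb` is finite
  have hfin : MeasureTheory.IsFiniteMeasure
      ((MeasureTheory.volume : MeasureTheory.Measure
        (Literature.MathematicalPhysics.KineticTheory.HeatConduction.PhaseSpace N)).withDensity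
        (fun x => ENNReal.ofReal (Real.exp (-W x)))) := by
    rw [← hμW]
    haveI := hμ.1
    infer_instance
  -- Borell on phase space (stub 2), pushed to the window marginal (seam)
  have hBor := h2 N W hW hfin
  subst hμW
  exact window_borell _ hBor a n h A B θ hA hB hθ hθ1

/-- The same composition at the registered stubs: the crux BY NAME, its `sorry`s exactly those of
`stub_uniformModulus` and `stub_prekopaLeindlerBorell`. -/
theorem NessWindowLogConcavity_skeleton :
    _root_.Summit.AtomisticToContinuum.FouriersLaw.Theses.LogConcaveRigidity.NessWindowLogConcavity :=
  NessWindowLogConcavity_of stub_uniformModulus stub_prekopaLeindlerBorell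

end Birth

end Summit.AtomisticToContinuum.FouriersLaw.Cruxes.NessWindowLogConcavity

end
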